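import Literature.Probability.RandomPlanarGeometry.SAWBrickWallHex
import Literature.Probability.RandomPlanarGeometry.SAWUnfolding
import Mathlib.Data.List.GetD
import HarnessLib

/-!
# Self-avoiding walks of the hexagonal lattice in brick-wall coordinates: walks, bridges,
# half-space walks, and the Hammersley–Welsh unfolding `h_n(ℍ) ≤ e^{3√n} b_n(ℍ)`

Topic `Literature/Probability/RandomPlanarGeometry` (continues `SAWBrickWallHex.lean`: the brick wall
`brickWallGraph` — `ℤ²` without the vertical bonds `{(x, y), (x, y+1)}`, `x + y` odd — IS the honeycomb
lattice, `bwIso : brickWallGraph ≃g hvGraph`, `sawCount_brickWall : c_n(brick wall) = c_n(ℍ)`; and the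
`ℤ^d` files `SAWCount` / `SAWBridges` / `SAWUnfoldingStep` / `SAWUnfolding`: the vertex-function model
`Zd.saws d n`, bridges and half-space walks by the FIRST coordinate, Madras–Slade Definition 1.2.4 and
Definition 3.1.2, and the unfolding `Zd.unfold` with `#T ≤ e^{3√n} · #(unfold '' T)`).

Sources: N. Madras, G. Slade, *The Self-Avoiding Walk* (1993), §1.2 (Definition 1.2.4: bridges),
§3.1 (Definition 3.1.2: half-space walks; Proposition 3.1.5: `h_N ≤ P_D(N) b_N` by the Hammersley–Welsh
unfolding [cite: HammersleyWelsh1962]); the brick-wall ("brickwork") picture of the honeycomb lattice: I. G. Enting,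
I. Jensen, *Exact enumerations*, Ch. 7 of A. J. Guttmann (ed.), *Polygons, Polyominoes and Polycubes*, LNP 775
(2009), §7.4.2, Fig. 7.10 ("the honeycomb lattice as a square lattice with some edges removed, resulting in a
brickwork lattice") [cite: EntingJensen2009, §7.4.2, Fig. 7.10].

## Why the brick wall, and why coordinate `0`

The brick wall is a spanning subgraph of `ℤ²`, so an `n`-step self-avoiding walk of the honeycomb lattice
read in brick-wall coordinates IS an element of the tree's `Zd.saws 2 n` whose steps happen to be brick-wall
bonds: `HexBW.saws n := (Zd.saws 2 n).filter (IsBW n)`.  Consequently every graph-free statement of the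
`ℤ^d` files (the unfolding `Zd.unfold`, `Zd.card_le_exp_mul_card_image_unfold`, `Zd.unfold_mem_bridges`,
the last minimum / last maximum bookkeeping) applies to these walks AS IS, and only the preservation of
"all steps are brick-wall bonds" has to be proved for each construction.  The height is coordinate `0`
(horizontal): the reflection `Zd.reflCoord ℓ` (`x ↦ 2ℓ − x`) is an automorphism of the brick wall for
every `ℓ` (it preserves the parity `x + y`), so the printed unfolding (reflection of the part of a walk
after the last time its height is maximal) needs no change; vertical bonds are the zero-height steps.
A translation by `t` is an automorphism iff `t₀ + t₁` is even; where a construction translates a walk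
by a site of odd parity we compose with `negY : (x, y) ↦ (x, −y)`, which exchanges the brick wall and
its odd twin and fixes the height (the "parity twist" `twistAt`).  (The tree's Duminil-Copin–Smirnov
bridges of `HexSAWBridges.lean` live in the OTHER frame — the level `lev = 2x₁ + bit`, along the vertical
hexagon edges, where every edge changes the level; that frame has no level-reversing automorphism
preserving the two vertex classes and is not used here.)

## Contents (namespace `Literature.Probability.RandomPlanarGeometry.SAW.HexBW`, all PROVED)

* arithmetic of the brick wall (on top of `brickWallGraph_adj_coord`): `parity_of_adj`, `adj_reflCoord`, `negY`, `twistAt`,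
  `adj_twistAt_sub_iff` / `adj_twistAt_add_iff` (placing a walk at a site of either parity),
  `adj_sigma_iff` (the reflection–translation of the splice);
* `IsBW n ω`, **`saws n`** (`⊆ Zd.saws 2 n`), `mem_saws_iff`, `parity_apply`, and
  **`card_saws : #(saws n) = c_n(ℍ)`** (via the list model `sawLists brickWallGraph 0 n`);
* `bridges n`, `bridgeCount n = b_n(ℍ)`, `halfSpaceWalks n`, `halfSpaceCount n = h_n(ℍ)` (Madras–Slade's
  definitions by coordinate `0`, i.e. the tree predicates `Zd.IsBridge`, `Zd.IsHalfSpace`), `b_n ≤ c_n(ℍ)`,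
  `1 ≤ b_n`;
* `unfoldStep_mem`, `unfold_mem`, `unfold_mem_bridges` and
  **`halfSpaceCount_le_exp_mul_bridgeCount : h_n(ℍ) ≤ e^{3√n} b_n(ℍ)`** (Proposition 3.1.5 on `ℍ`).
-/

noncomputable section

open Finset Function Literature.Probability.LatticeModels Literature.Probability.Percolation SimpleGraph

namespace Literature.Probability.RandomPlanarGeometry.SAW

namespace HexBW

/-! ### Arithmetic of the brick wall -/

/-- A brick-wall bond is a bond of `ℤ²`. [cite: EntingJensen2009, §7.4.2, Fig. 7.10 (brickwork form of the honeycomb lattice)] -/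
theorem zd_adj_of_adj {x y : Site 2} (h : brickWallGraph.Adj x y) : (zdGraph 2).Adj x y :=
  brickWallGraph_le h

/-- Every brick-wall step changes the parity of `x + y`. [cite: EntingJensen2009, §7.4.2, Fig. 7.10 (brickwork form of the honeycomb lattice)] -/
theorem parity_of_adj {x y : Site 2} (h : brickWallGraph.Adj x y) :
    (y 0 + y 1) % 2 = (x 0 + x 1 + 1) % 2 := by
  rw [brickWallGraph_adj_coord] at h
  omega

/-- A step changes the height (coordinate `0`) by at most one. [cite: EntingJensen2009, §7.4.2, Fig. 7.10 (brickwork form of the honeycomb lattice)] -/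
theorem abs_sub_apply_zero_le_one {x y : Site 2} (h : brickWallGraph.Adj x y) : |y 0 - x 0| ≤ 1 := by
  rw [brickWallGraph_adj_coord] at h
  rw [abs_le]
  omega

/-- A step to a strictly lower height is the horizontal step `−e₀`. [cite: EntingJensen2009, §7.4.2, Fig. 7.10 (brickwork form of the honeycomb lattice)] -/
theorem eq_sub_single_of_adj_of_lt {x y : Site 2} (h : brickWallGraph.Adj x y) (hlt : y 0 < x 0) :
    y = x - Pi.single 0 1 := by
  rw [brickWallGraph_adj_coord] at h
  funext j
  fin_cases j
  · simp only [Fin.zero_eta, Pi.sub_apply, Pi.single_eq_same]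
    omega
  · simp only [Fin.mk_one, Pi.sub_apply, Pi.single_eq_of_ne (one_ne_zero : (1 : Fin 2) ≠ 0), sub_zero]
    omega

/-- A step to a strictly larger height is the horizontal step `+e₀`. [cite: EntingJensen2009, §7.4.2, Fig. 7.10 (brickwork form of the honeycomb lattice)] -/
theorem eq_add_single_of_adj_of_gt {x y : Site 2} (h : brickWallGraph.Adj x y) (hgt : x 0 < y 0) :
    y = x + Pi.single 0 1 := by
  rw [brickWallGraph_adj_coord] at h
  funext j
  fin_cases j
  · simp only [Fin.zero_eta, Pi.add_apply, Pi.single_eq_same]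
    omega
  · simp only [Fin.mk_one, Pi.add_apply, Pi.single_eq_of_ne (one_ne_zero : (1 : Fin 2) ≠ 0), add_zero]
    omega

/-- The horizontal bond `{x, x + e₀}` is always present. [cite: EntingJensen2009, §7.4.2, Fig. 7.10 (brickwork form of the honeycomb lattice)] -/
theorem adj_add_single (x : Site 2) : brickWallGraph.Adj x (x + Pi.single 0 1) := by
  rw [brickWallGraph_adj_coord]
  left
  simp

/-- The reflection of the height `x ↦ 2ℓ − x` is an automorphism of the brick wall (it preserves the
parity of `x + y`). [cite: EntingJensen2009, §7.4.2, Fig. 7.10 (brickwork form of the honeycomb lattice)] -/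
theorem adj_reflCoord (ℓ : ℤ) {x y : Site 2} (h : brickWallGraph.Adj x y) :
    brickWallGraph.Adj (Zd.reflCoord ℓ x) (Zd.reflCoord ℓ y) := by
  have h1 : (1 : Fin 2) ≠ 0 := by decide
  simp only [brickWallGraph_adj_coord, Zd.reflCoord_apply_zero, Zd.reflCoord_apply_of_ne _ _ h1] at h ⊢
  omega

/-- The reflection of the height is an automorphism of the brick wall (iff form). [cite: EntingJensen2009, §7.4.2, Fig. 7.10 (brickwork form of the honeycomb lattice)] -/
theorem adj_reflCoord_iff (ℓ : ℤ) (x y : Site 2) :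
    brickWallGraph.Adj (Zd.reflCoord ℓ x) (Zd.reflCoord ℓ y) ↔ brickWallGraph.Adj x y := by
  refine ⟨fun h => ?_, adj_reflCoord ℓ⟩
  have := adj_reflCoord ℓ h
  rwa [Zd.reflCoord_reflCoord, Zd.reflCoord_reflCoord] at this

/-- `negY (x, y) = (x, −y)`: exchanges the brick wall with its odd twin, fixes the height. [cite: EntingJensen2009, §7.4.2, Fig. 7.10 (brickwork form of the honeycomb lattice)] -/
def negY (x : Site 2) : Site 2 := Function.update x 1 (-x 1)

/-- Height of `negY x`. [cite: EntingJensen2009, §7.4.2, Fig. 7.10 (brickwork form of the honeycomb lattice)] -/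
@[simp] theorem negY_apply_zero (x : Site 2) : negY x 0 = x 0 := by
  simp [negY]

/-- Second coordinate of `negY x`. [cite: EntingJensen2009, §7.4.2, Fig. 7.10 (brickwork form of the honeycomb lattice)] -/
@[simp] theorem negY_apply_one (x : Site 2) : negY x 1 = -x 1 := by
  simp [negY]

/-- `negY` is an involution. [cite: EntingJensen2009, §7.4.2, Fig. 7.10 (brickwork form of the honeycomb lattice)] -/
@[simp] theorem negY_negY (x : Site 2) : negY (negY x) = x := by
  funext j
  fin_cases j <;> simp

/-- `negY` is injective. [cite: EntingJensen2009, §7.4.2, Fig. 7.10 (brickwork form of the honeycomb lattice)] -/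
theorem negY_injective : Function.Injective negY := fun x y h => by
  rw [← negY_negY x, h, negY_negY]

/-- `negY 0 = 0`. [cite: EntingJensen2009, §7.4.2, Fig. 7.10 (brickwork form of the honeycomb lattice)] -/
@[simp] theorem negY_zero : negY (0 : Site 2) = 0 := by
  funext j
  fin_cases j <;> simp

/-- The **parity twist at `p`**: the identity if `p₀ + p₁` is even, `negY` if it is odd. [cite: EntingJensen2009, §7.4.2, Fig. 7.10 (brickwork form of the honeycomb lattice)] -/
def twistAt (p : Site 2) (z : Site 2) : Site 2 := if (p 0 + p 1) % 2 = 0 then z else negY z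

/-- The twist fixes the height. [cite: EntingJensen2009, §7.4.2, Fig. 7.10 (brickwork form of the honeycomb lattice)] -/
@[simp] theorem twistAt_apply_zero (p z : Site 2) : twistAt p z 0 = z 0 := by
  unfold twistAt
  split_ifs <;> simp

/-- The twist is an involution. [cite: EntingJensen2009, §7.4.2, Fig. 7.10 (brickwork form of the honeycomb lattice)] -/
@[simp] theorem twistAt_twistAt (p z : Site 2) : twistAt p (twistAt p z) = z := by
  unfold twistAt
  split_ifs <;> simp

/-- The twist is injective. [cite: EntingJensen2009, §7.4.2, Fig. 7.10 (brickwork form of the honeycomb lattice)] -/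
theorem twistAt_injective (p : Site 2) : Function.Injective (twistAt p) := fun x y h => by
  rw [← twistAt_twistAt p x, h, twistAt_twistAt]

/-- The twist fixes `0`. [cite: EntingJensen2009, §7.4.2, Fig. 7.10 (brickwork form of the honeycomb lattice)] -/
@[simp] theorem twistAt_zero (p : Site 2) : twistAt p 0 = 0 := by
  unfold twistAt
  split_ifs <;> simp

/-- The twist only depends on the parity of `p₀ + p₁`. [cite: EntingJensen2009, §7.4.2, Fig. 7.10 (brickwork form of the honeycomb lattice)] -/
theorem twistAt_congr {p q : Site 2} (h : (p 0 + p 1) % 2 = (q 0 + q 1) % 2) (z : Site 2) :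
    twistAt p z = twistAt q z := by
  unfold twistAt
  rw [h]

/-- **Reading a walk from the site `p`**: `z ↦ twistAt p (z − p)` carries brick-wall bonds to brick-wall
bonds (for `p` even this is a translation, for `p` odd a translation followed by `negY`). [cite: EntingJensen2009, §7.4.2, Fig. 7.10 (brickwork form of the honeycomb lattice)] -/
theorem adj_twistAt_sub_iff (p x y : Site 2) :
    brickWallGraph.Adj (twistAt p (x - p)) (twistAt p (y - p)) ↔ brickWallGraph.Adj x y := by
  unfold twistAt
  split_ifs with hp
  · simp only [brickWallGraph_adj_coord, Pi.sub_apply]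
    omega
  · simp only [brickWallGraph_adj_coord, negY_apply_zero, negY_apply_one, Pi.sub_apply]
    omega

/-- **Placing a walk at the site `p`**: `z ↦ twistAt p z + p` carries brick-wall bonds to brick-wall
bonds. [cite: EntingJensen2009, §7.4.2, Fig. 7.10 (brickwork form of the honeycomb lattice)] -/
theorem adj_twistAt_add_iff (p x y : Site 2) :
    brickWallGraph.Adj (twistAt p x + p) (twistAt p y + p) ↔ brickWallGraph.Adj x y := by
  unfold twistAt
  split_ifs with hp
  · simp only [brickWallGraph_adj_coord, Pi.add_apply]
    omega
  · simp only [brickWallGraph_adj_coord, negY_apply_zero, negY_apply_one, Pi.add_apply]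
    omega

/-- `twistAt p (z - p)` and `twistAt p · + p` are inverse to each other. [cite: EntingJensen2009, §7.4.2, Fig. 7.10 (brickwork form of the honeycomb lattice)] -/
theorem twistAt_sub_add (p z : Site 2) : twistAt p (twistAt p (z - p)) + p = z := by
  rw [twistAt_twistAt, sub_add_cancel]

/-- `twistAt p · + p` and `twistAt p (· - p)` are inverse to each other. [cite: EntingJensen2009, §7.4.2, Fig. 7.10 (brickwork form of the honeycomb lattice)] -/
theorem twistAt_add_sub (p z : Site 2) : twistAt p (twistAt p z + p - p) = z := by
  rw [add_sub_cancel_right, twistAt_twistAt]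

/-- **The reflection–translation of the splice**: `z ↦ c + R(z − a)`, `R` the reflection `x ↦ −x` of the
height, is an automorphism of the brick wall when `c` and `a` have the same parity. [cite: EntingJensen2009, §7.4.2, Fig. 7.10 (brickwork form of the honeycomb lattice)] -/
theorem adj_sigma_iff {c a : Site 2} (hca : (c 0 + c 1) % 2 = (a 0 + a 1) % 2) (x y : Site 2) :
    brickWallGraph.Adj (c + Zd.reflCoord 0 (x - a)) (c + Zd.reflCoord 0 (y - a)) ↔
      brickWallGraph.Adj x y := by
  have h1 : (1 : Fin 2) ≠ 0 := by decide
  simp only [brickWallGraph_adj_coord, Pi.add_apply, Pi.sub_apply, Zd.reflCoord_apply_zero,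
    Zd.reflCoord_apply_of_ne _ _ h1]
  omega

/-- `negY` is an automorphism of `ℤ²`. [cite: EntingJensen2009, §7.4.2, Fig. 7.10 (brickwork form of the honeycomb lattice)] -/
theorem zd_adj_negY_iff (x y : Site 2) : (zdGraph 2).Adj (negY x) (negY y) ↔ (zdGraph 2).Adj x y := by
  have hzd : ∀ x y : Site 2, (zdGraph 2).Adj x y ↔
      ((y 0 = x 0 + 1 ∨ x 0 = y 0 + 1) ∧ y 1 = x 1) ∨
        ((y 1 = x 1 + 1 ∨ x 1 = y 1 + 1) ∧ y 0 = x 0) := fun x y => by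
    rw [zdGraph_adj_iff, Fin.exists_fin_two]
    simp only [funext_iff, Fin.forall_fin_two, Pi.add_apply, Pi.single_eq_same,
      Pi.single_eq_of_ne (one_ne_zero : (1 : Fin 2) ≠ 0),
      Pi.single_eq_of_ne (zero_ne_one : (0 : Fin 2) ≠ 1), add_zero]
    omega
  rw [hzd, hzd, negY_apply_zero, negY_apply_zero, negY_apply_one, negY_apply_one]
  omega

/-- The twist is an automorphism of `ℤ²`. [cite: EntingJensen2009, §7.4.2, Fig. 7.10 (brickwork form of the honeycomb lattice)] -/
theorem zd_adj_twistAt_iff (p x y : Site 2) :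
    (zdGraph 2).Adj (twistAt p x) (twistAt p y) ↔ (zdGraph 2).Adj x y := by
  unfold twistAt
  split_ifs
  · exact Iff.rfl
  · exact zd_adj_negY_iff x y

/-! ### The walks -/

/-- All steps up to time `n` are brick-wall bonds. [cite: MadrasSlade1993, §1.1] -/
def IsBW (n : ℕ) (ω : ℕ → Site 2) : Prop := ∀ i < n, brickWallGraph.Adj (ω i) (ω (i + 1))

open Classical in
/-- **The `n`-step self-avoiding walks of the honeycomb lattice from `0`, in brick-wall coordinates**, as
vertex functions frozen after time `n`: the walks of `Zd.saws 2 n` whose steps are brick-wall bonds.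
[cite: MadrasSlade1993, §1.1] -/
def saws (n : ℕ) : Finset (ℕ → Site 2) := (Zd.saws 2 n).filter (IsBW n)

/-- Membership in `saws`. [cite: MadrasSlade1993, §1.1] -/
theorem mem_saws {n : ℕ} {ω : ℕ → Site 2} : ω ∈ saws n ↔ ω ∈ Zd.saws 2 n ∧ IsBW n ω := by
  classical
  exact Finset.mem_filter

/-- `saws n ⊆ Zd.saws 2 n`: a honeycomb walk is a `ℤ²` walk. [cite: MadrasSlade1993, §1.1] -/
theorem saws_subset (n : ℕ) : saws n ⊆ Zd.saws 2 n := fun _ h => (mem_saws.1 h).1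

/-- **Membership in `saws`, unfolded**: start at `0`, frozen after `n`, brick-wall steps, injective on
`[0, n]`. [cite: MadrasSlade1993, §1.1] -/
theorem mem_saws_iff {n : ℕ} {ω : ℕ → Site 2} :
    ω ∈ saws n ↔ ω 0 = 0 ∧ (∀ i, n ≤ i → ω i = ω n) ∧ IsBW n ω ∧ Set.InjOn ω {i | i ≤ n} := by
  rw [mem_saws, Zd.mem_saws]
  constructor
  · rintro ⟨⟨h0, hend, -, hinj⟩, hbw⟩
    exact ⟨h0, hend, hbw, hinj⟩
  · rintro ⟨h0, hend, hbw, hinj⟩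
    exact ⟨⟨h0, hend, fun i hi => zd_adj_of_adj (hbw i hi), hinj⟩, hbw⟩

/-- **The parity invariant**: after `i` steps from `0` the walk is at a site of parity `i`.
[cite: MadrasSlade1993, §1.1] -/
theorem parity_apply {n : ℕ} {ω : ℕ → Site 2} (hω : ω ∈ saws n) {i : ℕ} (hi : i ≤ n) :
    (ω i 0 + ω i 1) % 2 = (i : ℤ) % 2 := by
  obtain ⟨h0, -, hbw, -⟩ := mem_saws_iff.1 hω
  induction i with
  | zero => simp [h0]
  | succ i ih =>
    have h := parity_of_adj (hbw i (by omega))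
    rw [h, Int.add_emod, ih (by omega)]
    push_cast
    omega

/-! ### `#(saws n) = c_n(ℍ)` via the list model -/

section ListModel

variable {n : ℕ} {l : List (Site 2)}

/-- Length of a walk of the list model. [cite: MadrasSlade1993, §1.1] -/
private theorem length_of_mem (h : l ∈ sawLists brickWallGraph (0 : Site 2) n) : l.length = n + 1 :=
  (mem_sawLists_iff.1 h).2.2.1

/-- Consecutive vertices are adjacent. [cite: MadrasSlade1993, §1.1] -/
private theorem adj_getD_of_mem (h : l ∈ sawLists brickWallGraph (0 : Site 2) n) {i : ℕ} (hi : i + 1 ≤ n) :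
    brickWallGraph.Adj (l.getD i 0) (l.getD (i + 1) 0) := by
  have hl := length_of_mem h
  have hc := List.isChain_iff_getElem.1 (mem_sawLists_iff.1 h).1 i (by omega)
  rwa [List.getElem_eq_getD (0 : Site 2), List.getElem_eq_getD (0 : Site 2)] at hc

/-- The walk starts at `0`. [cite: MadrasSlade1993, §1.1] -/
private theorem getD_zero_of_mem (h : l ∈ sawLists brickWallGraph (0 : Site 2) n) : l.getD 0 0 = 0 := by
  have hh := (mem_sawLists_iff.1 h).2.1
  rw [List.head?_eq_getElem?] at hh
  rw [List.getD_eq_getElem?_getD, hh, Option.getD_some]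

/-- Vertex access is injective. [cite: MadrasSlade1993, §1.1] -/
private theorem getD_injOn_of_mem (h : l ∈ sawLists brickWallGraph (0 : Site 2) n) {i j : ℕ}
    (hi : i < n + 1) (hj : j < n + 1) (e : l.getD i 0 = l.getD j 0) : i = j := by
  have hl := length_of_mem h
  have hn := (mem_sawLists_iff.1 h).2.2.2
  rw [← List.getElem_eq_getD (h := by omega), ← List.getElem_eq_getD (h := by omega)] at e
  exact (List.Nodup.getElem_inj_iff hn).1 e

/-- A constructor for membership in the list model. [cite: MadrasSlade1993, §1.1] -/
private theorem mem_of (hlen : l.length = n + 1) (h0 : l.getD 0 0 = 0)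
    (hchain : ∀ i, i + 1 ≤ n → brickWallGraph.Adj (l.getD i 0) (l.getD (i + 1) 0)) (hnodup : l.Nodup) :
    l ∈ sawLists brickWallGraph (0 : Site 2) n := by
  refine mem_sawLists_iff.2 ⟨?_, ?_, hlen, hnodup⟩
  · refine List.isChain_iff_getElem.2 fun i hi => ?_
    rw [List.getElem_eq_getD (0 : Site 2), List.getElem_eq_getD (0 : Site 2)]
    exact hchain i (by omega)
  · rw [List.head?_eq_getElem?, List.getElem?_eq_getElem (show 0 < l.length by omega),
      List.getElem_eq_getD (0 : Site 2), h0]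

/-- A vertex list read as a vertex function frozen after time `n`. [cite: MadrasSlade1993, §1.1] -/
def ofList (n : ℕ) (l : List (Site 2)) : ℕ → Site 2 := fun i => l.getD (min i n) 0

/-- `ofList n` is injective on the list model. [cite: MadrasSlade1993, §1.1] -/
theorem ofList_injOn (n : ℕ) : Set.InjOn (ofList n) (sawLists brickWallGraph (0 : Site 2) n) := by
  intro l hl l' hl' h
  have hlen := length_of_mem hl
  have hlen' := length_of_mem hl'
  refine List.ext_getElem (by rw [hlen, hlen']) fun i hi hi' => ?_
  have := congrFun h i
  rw [ofList, ofList, min_eq_left (by omega : i ≤ n)] at this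
  rwa [← List.getElem_eq_getD (h := hi), ← List.getElem_eq_getD (h := hi')] at this

/-- The image of the list model under `ofList n` is `saws n`. [cite: MadrasSlade1993, §1.1] -/
theorem ofList_image (n : ℕ) :
    ofList n '' sawLists brickWallGraph (0 : Site 2) n = ↑(saws n) := by
  ext ω
  constructor
  · rintro ⟨l, hl, rfl⟩
    have hlen := length_of_mem hl
    rw [Finset.mem_coe, mem_saws_iff]
    refine ⟨?_, ?_, ?_, ?_⟩
    · simp only [ofList, Nat.zero_min, getD_zero_of_mem hl]
    · intro i hi
      simp only [ofList, min_eq_right hi, min_self]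
    · intro i hi
      simp only [ofList, min_eq_left hi.le, min_eq_left (by omega : i + 1 ≤ n)]
      exact adj_getD_of_mem hl (by omega)
    · intro i hi j hj hij
      simp only [Set.mem_setOf_eq] at hi hj
      simp only [ofList, min_eq_left hi, min_eq_left hj] at hij
      exact getD_injOn_of_mem hl (by omega) (by omega) hij
  · intro hω
    rw [Finset.mem_coe, mem_saws_iff] at hω
    obtain ⟨h0, hend, hadj, hinj⟩ := hω
    set l : List (Site 2) := (List.range (n + 1)).map fun i => ω i with hl
    have hlen : l.length = n + 1 := by simp [hl]
    have hget : ∀ i, i ≤ n → l.getD i 0 = ω i := by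
      intro i hi
      rw [hl, List.getD_eq_getElem _ _ (by simp; omega)]
      simp
    have hmem : l ∈ sawLists brickWallGraph (0 : Site 2) n := by
      refine mem_of hlen ?_ ?_ ?_
      · rw [hget 0 (Nat.zero_le n), h0]
      · intro i hi
        rw [hget i (by omega), hget (i + 1) (by omega)]
        exact hadj i (by omega)
      · rw [hl]
        refine List.Nodup.map_on (fun i hi j hj hij => ?_) List.nodup_range
        rw [List.mem_range] at hi hj
        exact hinj (show i ≤ n by omega) (show j ≤ n by omega) hij
    refine ⟨l, hmem, funext fun i => ?_⟩
    rw [ofList, hget _ (Nat.min_le_right i n)]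
    rcases le_or_gt i n with hi | hi
    · rw [min_eq_left hi]
    · rw [min_eq_right hi.le, hend i hi.le]

end ListModel

/-- **`#(saws n) = c_n(ℍ)`**. [cite: DuminilCopinSmirnov2012, §1 (`c_n`)] -/
theorem card_saws (n : ℕ) : #(saws n) = hexSawCount n := by
  rw [← sawCount_brickWall, sawCount_eq_ncard_sawLists brickWallGraph, ← Set.ncard_coe_finset,
    ← ofList_image, (ofList_injOn n).ncard_image]

/-- The set of honeycomb walks is non-empty. [cite: MadrasSlade1993, §1.1] -/
theorem card_saws_pos (n : ℕ) : 0 < #(saws n) := by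
  rw [card_saws]
  exact hexSawCount_pos n

/-! ### Bridges and half-space walks (by the height, coordinate `0`) -/

open Classical in
/-- **The `n`-step bridges of `ℍ` from `0`** (height = brick-wall coordinate `0`):
`ω(0)₀ < ω(i)₀ ≤ ω(n)₀` for `1 ≤ i ≤ n`. [cite: MadrasSlade1993, Definition 1.2.4] -/
def bridges (n : ℕ) : Finset (ℕ → Site 2) := (saws n).filter (Zd.IsBridge n)

/-- `b_n(ℍ)`, the number of `n`-step bridges from `0` (`b₀ = 1`). [cite: MadrasSlade1993, Definition 1.2.4] -/
def bridgeCount (n : ℕ) : ℕ := #(bridges n)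

open Classical in
/-- The `n`-step half-space walks of `ℍ` from `0`: `ω(0)₀ < ω(i)₀` for `1 ≤ i ≤ n`.
[cite: MadrasSlade1993, Definition 3.1.2] -/
def halfSpaceWalks (n : ℕ) : Finset (ℕ → Site 2) := (saws n).filter (Zd.IsHalfSpace n)

/-- `h_n(ℍ)`, the number of `n`-step half-space walks from `0`. [cite: MadrasSlade1993, Definition 3.1.2] -/
def halfSpaceCount (n : ℕ) : ℕ := #(halfSpaceWalks n)

/-- Membership in `bridges`. [cite: MadrasSlade1993, Definition 1.2.4] -/
theorem mem_bridges {n : ℕ} {ω : ℕ → Site 2} : ω ∈ bridges n ↔ ω ∈ saws n ∧ Zd.IsBridge n ω := by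
  classical
  exact Finset.mem_filter

/-- Membership in `halfSpaceWalks`. [cite: MadrasSlade1993, Definition 3.1.2] -/
theorem mem_halfSpaceWalks {n : ℕ} {ω : ℕ → Site 2} :
    ω ∈ halfSpaceWalks n ↔ ω ∈ saws n ∧ Zd.IsHalfSpace n ω := by
  classical
  exact Finset.mem_filter

/-- Honeycomb bridges are `ℤ²` bridges. [cite: MadrasSlade1993, §1.1] -/
theorem bridges_subset_zd (n : ℕ) : bridges n ⊆ Zd.bridges 2 n := fun ω h => by
  rw [mem_bridges] at h
  exact Zd.mem_bridges.2 ⟨saws_subset n h.1, h.2⟩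

/-- Honeycomb half-space walks are `ℤ²` half-space walks. [cite: MadrasSlade1993, §1.1] -/
theorem halfSpaceWalks_subset_zd (n : ℕ) : halfSpaceWalks n ⊆ Zd.halfSpaceWalks 2 n := fun ω h => by
  rw [mem_halfSpaceWalks] at h
  exact Zd.mem_halfSpaceWalks.2 ⟨saws_subset n h.1, h.2⟩

/-- `b_n(ℍ) ≤ c_n(ℍ)`. [cite: MadrasSlade1993, §1.2] -/
theorem bridgeCount_le (n : ℕ) : bridgeCount n ≤ hexSawCount n := by
  classical
  rw [bridgeCount, bridges, ← card_saws]
  exact Finset.card_filter_le _ _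

/-- Bridges are half-space walks. [cite: MadrasSlade1993, §3.1] -/
theorem bridges_subset_halfSpaceWalks (n : ℕ) : bridges n ⊆ halfSpaceWalks n := fun ω hω => by
  rw [mem_bridges] at hω
  exact mem_halfSpaceWalks.2 ⟨hω.1, hω.2.isHalfSpace⟩

/-- `h_n(ℍ) ≤ c_n(ℍ)`. [cite: MadrasSlade1993, §3.1] -/
theorem halfSpaceCount_le (n : ℕ) : halfSpaceCount n ≤ hexSawCount n := by
  classical
  rw [halfSpaceCount, halfSpaceWalks, ← card_saws]
  exact Finset.card_filter_le _ _

/-- The straight horizontal walk is a honeycomb walk. [cite: MadrasSlade1993, §1.1] -/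
theorem straightWalk_mem (n : ℕ) : Zd.straightWalk 2 n ∈ saws n := by
  refine mem_saws.2 ⟨Zd.straightWalk_mem_saws 2 n, fun i hi => ?_⟩
  have h : Zd.straightWalk 2 n (i + 1) = Zd.straightWalk 2 n i + Pi.single 0 1 := by
    have h1 : min i n = i := min_eq_left hi.le
    have h2 : min (i + 1) n = i + 1 := min_eq_left (by omega)
    simp only [Zd.straightWalk, h1, h2, ← Pi.single_add]
    congr 1
  rw [h]
  exact adj_add_single _

/-- The straight walk is a bridge: `1 ≤ b_n(ℍ)`. [cite: MadrasSlade1993, §1.2] -/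
theorem one_le_bridgeCount (n : ℕ) : 1 ≤ bridgeCount n := by
  refine Finset.card_pos.2 ⟨Zd.straightWalk 2 n, mem_bridges.2 ⟨straightWalk_mem n, ?_⟩⟩
  intro i h1 h2
  simp only [Zd.straightWalk, Pi.single_eq_same, min_eq_left h2, min_self, Nat.zero_min, Nat.cast_zero]
  exact ⟨by exact_mod_cast h1, by exact_mod_cast h2⟩

/-- `b₀(ℍ) = 1` (only the trivial walk). [cite: MadrasSlade1993, §1.1] -/
theorem bridgeCount_zero : bridgeCount 0 = 1 := by
  refine le_antisymm ?_ (one_le_bridgeCount 0)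
  calc bridgeCount 0 ≤ hexSawCount 0 := bridgeCount_le 0
    _ = 1 := hexSawCount_zero

/-! ### The Hammersley–Welsh unfolding preserves honeycomb walks -/

/-- **The unfolding step maps honeycomb walks to honeycomb walks**: up to the last maximum nothing
changes, after it every step is reflected (an automorphism), and the junction step starts at the fixed
hyperplane. [cite: MadrasSlade1993, §3.1 (proof of Proposition 3.1.5)] -/
theorem isBW_unfoldStep {n : ℕ} {ω : ℕ → Site 2} (hbw : IsBW n ω) : IsBW n (Zd.unfoldStep n ω) := by
  intro i hi
  set p := Zd.lastArgmax n ω with hp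
  set ℓ := Zd.maxLevel n ω with hℓ
  have hfix : Zd.reflCoord ℓ (ω p) = ω p := (Zd.reflCoord_eq_self_iff ℓ (ω p)).2 (Zd.lastArgmax_spec n ω).2
  by_cases h1 : i + 1 ≤ p
  · rw [Zd.unfoldStep, Zd.reflectFrom_of_le ω h1, Zd.reflectFrom_of_le ω (by omega : i ≤ p)]
    exact hbw i hi
  · by_cases h2 : i ≤ p
    · have hip : i = p := by omega
      rw [Zd.unfoldStep, Zd.reflectFrom_of_le ω h2, Zd.reflectFrom_of_lt ω (by omega : p < i + 1), hip,
        ← hfix]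
      exact adj_reflCoord ℓ (hip ▸ hbw i hi)
    · rw [Zd.unfoldStep, Zd.reflectFrom_of_lt ω (by omega : p < i),
        Zd.reflectFrom_of_lt ω (by omega : p < i + 1)]
      exact adj_reflCoord ℓ (hbw i hi)

/-- The unfolding step maps `saws n` to `saws n`. [cite: MadrasSlade1993, §3.1 (proof of Proposition 3.1.5)] -/
theorem unfoldStep_mem {n : ℕ} {ω : ℕ → Site 2} (hω : ω ∈ saws n) : Zd.unfoldStep n ω ∈ saws n := by
  rw [mem_saws] at hω ⊢
  exact ⟨Zd.unfoldStep_mem_saws hω.1, isBW_unfoldStep hω.2⟩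

/-- Iterates of the step stay in `saws n`. [cite: MadrasSlade1993, §3.1 (proof of Proposition 3.1.5)] -/
theorem iterate_unfoldStep_mem {n : ℕ} {ω : ℕ → Site 2} (hω : ω ∈ saws n) (k : ℕ) :
    (Zd.unfoldStep n)^[k] ω ∈ saws n := by
  induction k with
  | zero => exact hω
  | succ k ih => rw [Function.iterate_succ_apply']; exact unfoldStep_mem ih

/-- The full unfolding of a honeycomb walk is a honeycomb walk. [cite: MadrasSlade1993, §3.1 (proof of Proposition 3.1.5)] -/
theorem unfold_mem {n : ℕ} {ω : ℕ → Site 2} (hω : ω ∈ saws n) : Zd.unfold n ω ∈ saws n :=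
  iterate_unfoldStep_mem hω (n + 1)

/-- **Honeycomb half-space walks are unfolded into honeycomb bridges.**
[cite: MadrasSlade1993, §3.1 (proof of Proposition 3.1.5)] -/
theorem unfold_mem_bridges {n : ℕ} {ω : ℕ → Site 2} (hω : ω ∈ halfSpaceWalks n) :
    Zd.unfold n ω ∈ bridges n := by
  have h1 := Zd.unfold_mem_bridges (halfSpaceWalks_subset_zd n hω)
  rw [Zd.mem_bridges] at h1
  exact mem_bridges.2 ⟨unfold_mem (mem_halfSpaceWalks.1 hω).1, h1.2⟩

/-- **Madras–Slade, Proposition 3.1.5 on the honeycomb lattice: `h_n(ℍ) ≤ e^{3√n} b_n(ℍ)`** — the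
tree's unfolding bound `#T ≤ e^{3√n} · #(unfold '' T)` for `T` = the honeycomb half-space walks, whose
unfolded images are honeycomb bridges. [cite: MadrasSlade1993, Proposition 3.1.5] -/
theorem halfSpaceCount_le_exp_mul_bridgeCount (n : ℕ) :
    (halfSpaceCount n : ℝ) ≤ Real.exp (3 * Real.sqrt n) * bridgeCount n := by
  classical
  have hT : halfSpaceWalks n ⊆ Zd.saws 2 n := fun ω hω => saws_subset n (mem_halfSpaceWalks.1 hω).1
  have himg : (halfSpaceWalks n).image (Zd.unfold n) ⊆ bridges n := by
    intro ξ hξ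
    obtain ⟨ω, hω, rfl⟩ := Finset.mem_image.1 hξ
    exact unfold_mem_bridges hω
  calc (halfSpaceCount n : ℝ) = ((halfSpaceWalks n).card : ℝ) := rfl
    _ ≤ Real.exp (3 * Real.sqrt n) * ((halfSpaceWalks n).image (Zd.unfold n)).card :=
        Zd.card_le_exp_mul_card_image_unfold hT
    _ ≤ Real.exp (3 * Real.sqrt n) * bridgeCount n := by
        refine mul_le_mul_of_nonneg_left ?_ (Real.exp_nonneg _)
        exact_mod_cast Finset.card_le_card himg

end HexBW

end Literature.Probability.RandomPlanarGeometry.SAW
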